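import Summits.KontsevichZagierPeriods.KontsevichZagierPeriods.Theorems.SymplecticScissorsPlanarCompilerGreenAux1
import Summits.KontsevichZagierPeriods.KontsevichZagierPeriods.Theorems.SymplecticScissorsPlanarCompilerGreenAux2

/-!
# `PlanarCompiler` (stmt-KontsevichZagierPeriods-10058), line `twist-restoring-shear` — Green bookkeeping IV

Helper file for the lead's stub `stub_greenAssembly` (crux protocol, `--supports`): TELESCOPING OF
TRACES ALONG A SWEEP. For the flat strip structure produced by `stub_signedSweep` (strips
`(x_j, x_{j+1})` of `(0,1)`, stacked cells with graph functions `lo i ≤ hi i`, `lo = 0` at the bottom,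
`hi = 1 − t` at the top, consecutive cells sharing their graph) and a map `Θ` with the cell property
that kills the 1-dimensional instances of rules 1a/1b/2, the traces telescope:
`∑ᵢ (Θ[∫ F(t, hi i t)] − Θ[∫ F(t, lo i t)]) ≡ Θ[∫₀¹ F(t, 1−t)] − Θ[∫₀¹ F(t, 0)]` in the planar set-chain
group (`sum_theta_traces_sub_mem_planarGroup`). Inside a strip this is `sum_strips_telescope`;
across strips it is rule 1a in dimension one (`theta_sub_sum`), the finitely many partition points
being null.

No new definitions. [Kontsevich–Zagier 2001, §1.2; folklore]
-/

noncomputable section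

open MeasureTheory Set
open Literature.NumberTheory.Transcendental Literature.ModelTheory.ExponentialFields
open Summit.KontsevichZagierPeriods.SymplecticScissors.PlanarK0InjectiveNegative

namespace Summit.KontsevichZagierPeriods.SymplecticScissors.PlanarCompilerProof

/-- A point of `(0,1)` off the partition points `0 = x₀ < x₁ < ⋯ < x_k = 1` lies in some open
strip `(x_j, x_{j+1})`. [folklore] -/
theorem exists_strip_of_not_mem_range {k : ℕ} {x : Fin (k + 1) → ℝ}
    (hx0 : x 0 = 0) (hx1 : x (Fin.last k) = 1) {t : ℝ} (ht : t ∈ Ioo (0 : ℝ) 1)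
    (hnot : t ∉ Set.range x) : ∃ j : Fin k, t ∈ Ioo (x (Fin.castSucc j)) (x (Fin.succ j)) := by
  classical
  set S : Finset (Fin (k + 1)) := Finset.univ.filter fun j => x j ≤ t with hS
  have h0S : (0 : Fin (k + 1)) ∈ S := by
    simp only [hS, Finset.mem_filter, Finset.mem_univ, true_and, hx0]; exact ht.1.le
  have hSne : S.Nonempty := ⟨0, h0S⟩
  set j₀ := S.max' hSne with hj₀
  have hj₀S : j₀ ∈ S := Finset.max'_mem S hSne
  have hj₀le : x j₀ ≤ t := by
    have := hj₀S; simp only [hS, Finset.mem_filter, Finset.mem_univ, true_and] at this; exact this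
  have hj₀lt : x j₀ < t := lt_of_le_of_ne hj₀le fun h => hnot ⟨j₀, h⟩
  have hj₀ne : j₀ ≠ Fin.last k := by
    intro h; rw [h, hx1] at hj₀lt; linarith [ht.2]
  obtain ⟨j, hj⟩ := Fin.exists_castSucc_eq.mpr hj₀ne
  refine ⟨j, ?_, ?_⟩
  · rw [hj]; exact hj₀lt
  · by_contra hle
    push Not at hle
    have hmem : Fin.succ j ∈ S := by
      simp only [hS, Finset.mem_filter, Finset.mem_univ, true_and]; exact hle
    have := Finset.le_max' S _ hmem
    rw [← hj₀, ← hj] at this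
    exact absurd this (not_le.mpr Fin.castSucc_lt_succ)

/-- The points of `ℝ¹` whose coordinate lies in a finite set form a null set. [folklore] -/
theorem volume_setOf_apply_mem_eq_zero_of_finite {F : Set ℝ} (hF : F.Finite) :
    volume {z : Fin 1 → ℝ | z 0 ∈ F} = 0 := by
  have hsub : {z : Fin 1 → ℝ | z 0 ∈ F} ⊆ (fun a : ℝ => fun _ : Fin 1 => a) '' F := by
    intro z hz
    refine ⟨z 0, hz, ?_⟩
    ext i; fin_cases i; rfl
  exact measure_mono_null hsub ((hF.image _).measure_zero volume)

/-- **Telescoping of traces along a sweep.** See the module docstring. `Θ` has the cell property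
(`hcell`) and kills the 1-dimensional instances of rules 1a/1b/2 (`hmoves`); the strip structure is
the one of `stub_signedSweep`; `ρb`, `ρh` are the base and hypotenuse traces `[∫₀¹ F(t,0)]`,
`[∫₀¹ F(t, 1−t)]`. [Kontsevich–Zagier 2001, §1.2; folklore] -/
theorem sum_theta_traces_sub_mem_planarGroup (Θ : KZ.FormalRep →+ KZ.FormalRep)
    (hcell : ∀ ρ : KZ.IntegralRep 1, ∃ s t : KZ.IntegralRep 2,
      s.domain = {p : Fin 2 → ℝ | (fun _ : Fin 1 => p 0) ∈ ρ.domain ∧ 0 < p 1 ∧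
        p 1 < ρ.integrand (fun _ : Fin 1 => p 0)} ∧
      t.domain = {p : Fin 2 → ℝ | (fun _ : Fin 1 => p 0) ∈ ρ.domain ∧ 0 < p 1 ∧
        p 1 < -ρ.integrand (fun _ : Fin 1 => p 0)} ∧
      (∀ p ∈ s.domain, s.integrand p = 1) ∧ (∀ p ∈ t.domain, t.integrand p = 1) ∧
      Θ (KZ.of ρ) = KZ.of s - KZ.of t)
    (hmoves : ∀ x ∈ KZ.domainAddRel ∪ KZ.integrandAddRel ∪ KZ.changeOfVariablesRel, Θ x ∈ planarGroup)
    (F : (Fin 2 → ℝ) → ℝ) {k m : ℕ} (x : Fin (k + 1) → ℝ) (str : Fin m → Fin k) (lev : Fin m → ℕ)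
    (L : Fin k → ℕ) (lo hi : Fin m → ℝ → ℝ) (ρlo ρhi : Fin m → KZ.IntegralRep 1)
    (ρb ρh : KZ.IntegralRep 1)
    (hx : StrictMono x) (hx0 : x 0 = 0) (hx1 : x (Fin.last k) = 1)
    (hlev : ∀ i, lev i < L (str i)) (hinj : ∀ i j, str i = str j → lev i = lev j → i = j)
    (hsurj : ∀ (j : Fin k) (l : ℕ), l < L j → ∃ i, str i = j ∧ lev i = l) (hL : ∀ j, 0 < L j)
    (hlo0 : ∀ i, lev i = 0 → ∀ t ∈ Icc (x (Fin.castSucc (str i))) (x (Fin.succ (str i))), lo i t = 0)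
    (hhi1 : ∀ i, lev i + 1 = L (str i) →
      ∀ t ∈ Icc (x (Fin.castSucc (str i))) (x (Fin.succ (str i))), hi i t = 1 - t)
    (hshare : ∀ i j, str i = str j → lev j = lev i + 1 →
      ∀ t ∈ Icc (x (Fin.castSucc (str i))) (x (Fin.succ (str i))), lo j t = hi i t)
    (hρlod : ∀ i, (ρlo i).domain =
      {z : Fin 1 → ℝ | z 0 ∈ Ioo (x (Fin.castSucc (str i))) (x (Fin.succ (str i)))})
    (hρhid : ∀ i, (ρhi i).domain =
      {z : Fin 1 → ℝ | z 0 ∈ Ioo (x (Fin.castSucc (str i))) (x (Fin.succ (str i)))})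
    (hρloi : ∀ i, ∀ z ∈ (ρlo i).domain, (ρlo i).integrand z = F ![z 0, lo i (z 0)])
    (hρhii : ∀ i, ∀ z ∈ (ρhi i).domain, (ρhi i).integrand z = F ![z 0, hi i (z 0)])
    (hbd : ρb.domain = {z : Fin 1 → ℝ | z 0 ∈ Ioo (0 : ℝ) 1})
    (hhd : ρh.domain = {z : Fin 1 → ℝ | z 0 ∈ Ioo (0 : ℝ) 1})
    (hbi : ∀ z ∈ ρb.domain, ρb.integrand z = F ![z 0, 0])
    (hhi : ∀ z ∈ ρh.domain, ρh.integrand z = F ![z 0, 1 - z 0]) :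
    ∑ i, (Θ (KZ.of (ρhi i)) - Θ (KZ.of (ρlo i))) - (Θ (KZ.of ρh) - Θ (KZ.of ρb)) ∈ planarGroup := by
  classical
  -- bottom and top cells of each strip
  choose ib hib using fun j : Fin k => hsurj j 0 (hL j)
  choose it hit using fun j : Fin k => hsurj j (L j - 1) (Nat.sub_lt (hL j) one_pos)
  have hit' : ∀ j, lev (it j) + 1 = L (str (it j)) := fun j => by
    rw [(hit j).2, (hit j).1]; have := hL j; omega
  -- the strips as pieces of the unit interval
  set P : Fin k → Set (Fin 1 → ℝ) := fun j =>
    {z : Fin 1 → ℝ | z 0 ∈ Ioo (x (Fin.castSucc j)) (x (Fin.succ j))} with hP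
  have hPs : ∀ j, IsSemialgebraic ℚ (P j) := fun j => by
    have := (ρlo (ib j)).isSemialgebraic_domain
    rw [hρlod (ib j), (hib j).1] at this
    exact this
  have hPsub : ∀ j, P j ⊆ {z : Fin 1 → ℝ | z 0 ∈ Ioo (0 : ℝ) 1} := fun j z hz => by
    simp only [hP, mem_setOf_eq, mem_Ioo] at hz ⊢
    have h1 : (0 : ℝ) ≤ x (Fin.castSucc j) := by rw [← hx0]; exact hx.monotone (Fin.zero_le _)
    have h2 : x (Fin.succ j) ≤ 1 := by rw [← hx1]; exact hx.monotone (Fin.le_last _)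
    constructor <;> linarith [hz.1, hz.2]
  have hPdisj : ∀ j j', j ≠ j' → Disjoint (P j) (P j') := by
    intro j j' hne
    rw [Set.disjoint_left]
    intro z hz hz'
    simp only [hP, mem_setOf_eq, mem_Ioo] at hz hz'
    rcases lt_or_gt_of_ne hne with h | h
    · have : x (Fin.succ j) ≤ x (Fin.castSucc j') := hx.monotone (Fin.succ_le_castSucc_iff.mpr h)
      linarith [hz.2, hz'.1]
    · have : x (Fin.succ j') ≤ x (Fin.castSucc j) := hx.monotone (Fin.succ_le_castSucc_iff.mpr h)
      linarith [hz'.2, hz.1]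
  have hPnull : volume ({z : Fin 1 → ℝ | z 0 ∈ Ioo (0 : ℝ) 1} \ ⋃ j ∈ (Finset.univ : Finset (Fin k)),
      P j) = 0 := by
    refine measure_mono_null ?_ (volume_setOf_apply_mem_eq_zero_of_finite (Set.finite_range x))
    rintro z ⟨hz, hzn⟩
    by_contra hnot
    obtain ⟨j, hj⟩ := exists_strip_of_not_mem_range hx0 hx1 hz hnot
    exact hzn (mem_iUnion₂.mpr ⟨j, Finset.mem_univ j, hj⟩)
  -- rule 1a in dimension one: the base and the hypotenuse traces split over the strips
  have hbase : Θ (KZ.of ρb) - ∑ j, Θ (KZ.of (ρlo (ib j))) ∈ planarGroup := by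
    refine theta_sub_sum Θ hcell hmoves Finset.univ ρb P (fun j => ρlo (ib j)) (fun j _ => hPs j)
      (fun j _ => by rw [hbd]; exact hPsub j) (fun j _ j' _ h => hPdisj j j' h)
      (by rw [hbd]; exact hPnull) (fun j _ => by rw [hρlod (ib j), (hib j).1]) (fun j _ z hz => ?_)
    have hz' : z ∈ (ρlo (ib j)).domain := by rw [hρlod (ib j), (hib j).1]; exact hz
    rw [hbi z (hbd ▸ hPsub j hz), hρloi (ib j) z hz', hlo0 (ib j) (hib j).2 (z 0)]
    rw [(hib j).1]; exact Ioo_subset_Icc_self hz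
  have hhyp : Θ (KZ.of ρh) - ∑ j, Θ (KZ.of (ρhi (it j))) ∈ planarGroup := by
    refine theta_sub_sum Θ hcell hmoves Finset.univ ρh P (fun j => ρhi (it j)) (fun j _ => hPs j)
      (fun j _ => by rw [hhd]; exact hPsub j) (fun j _ j' _ h => hPdisj j j' h)
      (by rw [hhd]; exact hPnull) (fun j _ => by rw [hρhid (it j), (hit j).1]) (fun j _ z hz => ?_)
    have hz' : z ∈ (ρhi (it j)).domain := by rw [hρhid (it j), (hit j).1]; exact hz
    rw [hhi z (hhd ▸ hPsub j hz), hρhii (it j) z hz', hhi1 (it j) (hit' j) (z 0)]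
    rw [(hit j).1]; exact Ioo_subset_Icc_self hz
  -- pass to the quotient by `planarGroup` and telescope inside each strip
  set π : KZ.FormalRep →+ KZ.FormalRep ⧸ planarGroup := QuotientAddGroup.mk' planarGroup with hπ
  have hker : ∀ {a b : KZ.FormalRep}, a - b ∈ planarGroup → π a = π b := fun h => by
    rw [hπ, QuotientAddGroup.mk'_apply, QuotientAddGroup.mk'_apply, QuotientAddGroup.eq_iff_sub_mem]
    exact h
  have htel := sum_strips_telescope str lev L hlev hinj hsurj hL
    (fun i => π (Θ (KZ.of (ρlo i)))) (fun i => π (Θ (KZ.of (ρhi i))))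
    (fun j => π (Θ (KZ.of (ρlo (ib j))))) (fun j => π (Θ (KZ.of (ρhi (it j))))) ?_ ?_ ?_
  rotate_left
  · -- shared graphs
    intro i j hij hl
    refine hker (theta_congr Θ hmoves (by rw [hρhid i, hρlod j, hij]) fun z hz => ?_)
    have hzI : z 0 ∈ Icc (x (Fin.castSucc (str i))) (x (Fin.succ (str i))) := by
      rw [hρlod j, ← hij] at hz; exact Ioo_subset_Icc_self hz
    have hz2 : z ∈ (ρhi i).domain := by rw [hρhid i, hij, ← hρlod j]; exact hz
    rw [hρloi j z hz, hρhii i z hz2, hshare i j hij hl _ hzI]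
  · -- bottom cells
    intro i hl
    have : i = ib (str i) := hinj _ _ (hib (str i)).1.symm (by rw [hl, (hib (str i)).2])
    rw [← this]
  · -- top cells
    intro i hl
    have : i = it (str i) := hinj _ _ (hit (str i)).1.symm (by
      rw [(hit (str i)).2]; have := hlev i; omega)
    rw [← this]
  -- assemble
  have hfinal : π (∑ i, (Θ (KZ.of (ρhi i)) - Θ (KZ.of (ρlo i))) - (Θ (KZ.of ρh) - Θ (KZ.of ρb))) = 0 := by
    rw [map_sub, map_sub, map_sum]
    simp only [map_sub]
    rw [htel, Finset.sum_sub_distrib]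
    have e1 : ∑ j, π (Θ (KZ.of (ρhi (it j)))) = π (Θ (KZ.of ρh)) := by
      rw [← map_sum]; exact (hker hhyp).symm
    have e2 : ∑ j, π (Θ (KZ.of (ρlo (ib j)))) = π (Θ (KZ.of ρb)) := by
      rw [← map_sum]; exact (hker hbase).symm
    rw [e1, e2, sub_self]
  rw [hπ, QuotientAddGroup.mk'_apply, QuotientAddGroup.eq_zero_iff] at hfinal
  exact hfinal

/-- Registered anchor of this helper file (crux protocol `--supports`): telescoping of traces (`sum_theta_traces_sub_mem_planarGroup`). [folklore] -/
theorem stub_greenAux4 :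
    ∀ Θ : KZ.FormalRep →+ KZ.FormalRep, (∀ ρ : KZ.IntegralRep 1, ∃ s t : KZ.IntegralRep 2, s.domain = {p : Fin 2 → ℝ | (fun _ : Fin 1 => p 0) ∈ ρ.domain ∧ 0 < p 1 ∧ p 1 < ρ.integrand (fun _ : Fin 1 => p 0)} ∧ t.domain = {p : Fin 2 → ℝ | (fun _ : Fin 1 => p 0) ∈ ρ.domain ∧ 0 < p 1 ∧ p 1 < -ρ.integrand (fun _ : Fin 1 => p 0)} ∧ (∀ p ∈ s.domain, s.integrand p = 1) ∧ (∀ p ∈ t.domain, t.integrand p = 1) ∧ Θ (KZ.of ρ) = KZ.of s - KZ.of t) → (∀ x ∈ KZ.domainAddRel ∪ KZ.integrandAddRel ∪ KZ.changeOfVariablesRel, Θ x ∈ AddSubgroup.closure ((KZ.domainAddRel ∪ KZ.changeOfVariablesRel) ∩ (AddSubgroup.closure {x : KZ.FormalRep | ∃ s : KZ.IntegralRep 2, (∀ p ∈ s.domain, s.integrand p = 1) ∧ x = KZ.of s} : Set KZ.FormalRep))) → ∀ (F : (Fin 2 → ℝ) → ℝ) (k m : ℕ) (x : Fin (k + 1)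 → ℝ) (str : Fin m → Fin k) (lev : Fin m → ℕ) (L : Fin k → ℕ) (lo hi : Fin m → ℝ → ℝ) (ρlo ρhi : Fin m → KZ.IntegralRep 1) (ρb ρh : KZ.IntegralRep 1), StrictMono x → x 0 = 0 → x (Fin.last k) = 1 → (∀ i, lev i < L (str i)) → (∀ i j, str i = str j → lev i = lev j → i = j) → (∀ (j : Fin k) (l : ℕ), l < L j → ∃ i, str i = j ∧ lev i = l) → (∀ j, 0 < L j) → (∀ i, lev i = 0 → ∀ t ∈ Set.Icc (x (Fin.castSucc (str i))) (x (Fin.succ (str i))), lo i t = 0) → (∀ i, lev i + 1 = L (str i) → ∀ t ∈ Set.Icc (x (Fin.castSucc (str i))) (x (Fin.succ (str i))), hi i t = 1 - t) → (∀ i j, str i = str j → lev j = lev i + 1 → ∀ t ∈ Set.Icc (x (Fin.castSucc (str i))) (x (Fin.succ (str i))), lo j t = hi i t) → (∀ i, (ρlo i).domain = {z : Fin 1 → ℝ | z 0 ∈ Set.Ioo (x (Fin.castSucc (str i))) (x (Fin.succ (str i)))}) → (∀ i, (ρhi i).domain = {z : Fin 1 → ℝ | z 0 ∈ Set.Ioo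 (x (Fin.castSucc (str i))) (x (Fin.succ (str i)))}) → (∀ i, ∀ z ∈ (ρlo i).domain, (ρlo i).integrand z = F ![z 0, lo i (z 0)]) → (∀ i, ∀ z ∈ (ρhi i).domain, (ρhi i).integrand z = F ![z 0, hi i (z 0)]) → ρb.domain = {z : Fin 1 → ℝ | z 0 ∈ Set.Ioo 0 1} → ρh.domain = {z : Fin 1 → ℝ | z 0 ∈ Set.Ioo 0 1} → (∀ z ∈ ρb.domain, ρb.integrand z = F ![z 0, 0]) → (∀ z ∈ ρh.domain, ρh.integrand z = F ![z 0, 1 - z 0]) → ∑ i, (Θ (KZ.of (ρhi i)) - Θ (KZ.of (ρlo i))) - (Θ (KZ.of ρh) - Θ (KZ.of ρb)) ∈ AddSubgroup.closure ((KZ.domainAddRel ∪ KZ.changeOfVariablesRel) ∩ (AddSubgroup.closure {x : KZ.FormalRep | ∃ s : KZ.IntegralRep 2, (∀ p ∈ s.domain, s.integrand p = 1) ∧ x = KZ.of s} : Set KZ.FormalRep)) :=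
  fun Θ hc hm F _ _ x str lev L lo hi ρlo ρhi ρb ρh a b c d e f g h i j k l m n o p q r =>
    sum_theta_traces_sub_mem_planarGroup Θ hc hm F x str lev L lo hi ρlo ρhi ρb ρh a b c d e f g h i j k l m n o p q r

end Summit.KontsevichZagierPeriods.SymplecticScissors.PlanarCompilerProof
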